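import Summits.PneNP.PneNP.Theorems.SymmetryBudgetHamCompilesFWires
import Summits.PneNP.PneNP.Theorems.SymmetryBudgetHamCompilesFBlocks
import Summits.PneNP.PneNP.Theorems.SymmetryBudgetHamCompilesFStruct
import Summits.PneNP.PneNP.Theorems.SymmetryBudgetHamCompilesFAut
import Summits.PneNP.PneNP.Theorems.SymmetryBudgetHamCompilesFOut

/-!
# Stub `stub_symmetricF` of the line `kotzig-cutspan` (crux `SymmetryBudget.HamCompiles`,
# stmt-PneNP-10637): assembly of the F-side symmetric circuits (lead prover)

From the five obligations about the F-side DAG (`…FDag.lean`, `…FDagSem.lean`) — wire values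
(`stub_symmetricF_wires`), block gate equations (`stub_symmetricF_blocks`), structural gate
equations (`stub_symmetricF_struct`), acyclicity + automorphisms (`stub_symmetricF_aut`), size +
decoding (`stub_symmetricF_out`) — build, for every F-interface index `i`, the labelled DAG
`fDAG`, identify its gate values with the explicit semantics `fsem` (well-founded induction: the
values and the semantics solve the same gate equations), read the output (`fData m x i`), transfer
symmetry (`GateDAG.isSymmetricUnder_compile_iff`) and compile (`GateDAG.compile`): every bit of the
F-interface has a `Bud(m, ⌊log₂ m⌋)`-symmetric threshold circuit with `≤ q(m)` gates.
-/

-- `Summit.PneNP.PneNP.…` duplicates `PneNP` BY DESIGN (single-problem summit, D-0017).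
set_option linter.dupNamespace false

noncomputable section

namespace Summit.PneNP.PneNP.Theorems.HamCompilesKC

open Literature.Computability.Complexity
open Finset

namespace SymF

variable {m : ℕ}

/-! ### The DAG and its values -/

/-- The F-side DAG with output the interface index `i`. -/
def fDAG (hA : AutProps m) (i : FIdx m) : GateDAG (Fin m × Fin m) (FΛ m) where
  fn := ffn m
  args := fargs
  out := fout m i
  wf := hA.1

/-- Every gate function of the DAG is in the threshold basis (indeed in `acBasis`). -/
theorem ffn_mem_tcBasis (l : FΛ m) : ffn m l ∈ tcBasis := by
  refine acBasis_subset_tcBasis ?_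
  rcases l with l | f
  · exact SymA.rfn_mem_acBasis l
  · rcases f with _ | _ | ⟨e, c, c'⟩ | _ | _ | _ | _ | ⟨χ, k, κ⟩
    · exact or_mem_acBasis _
    · exact and_mem_acBasis _
    · exact const_mem_acBasis _
    · exact and_mem_acBasis _
    · exact or_mem_acBasis _
    · exact and_mem_acBasis _
    · exact and_mem_acBasis _
    · cases κ <;> first
        | exact and_mem_acBasis _
        | exact or_mem_acBasis _
        | exact mem_acBasis_not

/-- All gate equations, from the three semantic obligations. -/
theorem fsem_eq (x : Fin m × Fin m → Bool) (hW : WireVals m x) (hB : WireVals m x → BlockEqs m x)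
    (hS : WireVals m x → StructEqs m x) (l : FΛ m) :
    fsem m x l = (ffn m l).2 fun a => wsem m x (fargs l a) := by
  have hs := hS hW l
  rcases l with l | f
  · exact hs
  · rcases f with _ | _ | _ | _ | _ | _ | _ | ⟨χ, k, κ⟩
    · exact hs
    · exact hs
    · exact hs
    · exact hs
    · exact hs
    · exact hs
    · exact hs
    · exact hB hW χ k κ

/-- **The DAG computes the explicit semantics**: gate values and `fsem` solve the same gate
equations, so they agree (well-founded induction along the wiring). -/
theorem fDAG_val (x : Fin m × Fin m → Bool) (hW : WireVals m x) (hB : WireVals m x → BlockEqs m x)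
    (hS : WireVals m x → StructEqs m x) (hA : AutProps m) (i : FIdx m) (l : FΛ m) :
    (fDAG hA i).val x l = fsem m x l := by
  induction l using hA.1.induction with
  | _ l ih =>
    rw [(fDAG hA i).val_eq, fsem_eq x hW hB hS l]
    refine congrArg (ffn m l).2 (funext fun a => ?_)
    show GateDAG.wire x ((fDAG hA i).val x) (fargs l a) = wsem m x (fargs l a)
    cases hq : fargs l a with
    | inl q => rfl
    | inr l' => exact ih l' ⟨a, hq⟩

/-- The output of the DAG is the F-interface bit. -/
theorem fDAG_evalOut (x : Fin m × Fin m → Bool) (hW : WireVals m x)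
    (hB : WireVals m x → BlockEqs m x) (hS : WireVals m x → StructEqs m x) (hA : AutProps m)
    (hO : OutProps) (i : FIdx m) : (fDAG hA i).evalOut x = fData m x i := by
  classical
  have hval : (fDAG hA i).val x = fsem m x := funext (fDAG_val x hW hB hS hA i)
  have hw : ∀ w : FW m, GateDAG.wire x ((fDAG hA i).val x) w = wsem m x w := by
    intro w
    rw [hval]
    cases w <;> rfl
  unfold GateDAG.evalOut
  rw [hw]
  show wsem m x (fout m i) = fData m x i
  rw [hO.2 m x i]
  unfold fout
  by_cases hv : Valid i.1
  · simp only [hv, decide_true, Bool.true_and, if_true]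
    rw [hW.2.1]
    rfl
  · simp only [hv, decide_false, Bool.false_and, if_false]
    rfl

/-- The DAG is symmetric under the budget. -/
theorem fDAG_isSymm (hA : AutProps m) (i : FIdx m) :
    (fDAG hA i).IsSymm (GateDAG.diagMaps (Bud m (gOf m))) := by
  rintro π ⟨ρ, hρ, rfl⟩
  obtain ⟨hbij, hout, hfn, hargs⟩ := hA.2 ρ hρ
  refine ⟨Equiv.ofBijective _ hbij, ⟨hout i, hfn, fun l => ?_⟩⟩
  exact hargs l

/-- **Assembly at one index**: a Bud-symmetric threshold circuit with `card (FΛ m)` gates computing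
the F-interface bit `i`. -/
theorem hasSymCircuit_fData (hW : ∀ x : Fin m × Fin m → Bool, WireVals m x)
    (hB : ∀ x : Fin m × Fin m → Bool, WireVals m x → BlockEqs m x)
    (hS : ∀ x : Fin m × Fin m → Bool, WireVals m x → StructEqs m x) (hA : AutProps m)
    (hO : OutProps) (i : FIdx m) :
    HasSymCircuit tcBasis (Bud m (gOf m)) (Fintype.card (FΛ m)) (fun x => fData m x i) := by
  refine ⟨(fDAG hA i).compile, GateDAG.compile_isOver _ ffn_mem_tcBasis, ?_,
    (GateDAG.isSymmetricUnder_compile_iff _ _).2 (fDAG_isSymm hA i), fun x => ?_⟩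
  · rw [Circuit.size, GateDAG.compile_gates_length]
  · rw [GateDAG.compile_eval]
    exact fDAG_evalOut x (hW x) (hB x) (hS x) hA hO i

end SymF

/-- **stub_symmetricF** (the F-side of the line, registered on crux stmt-PneNP-10637): every
F-interface bit has a polynomial-size `Bud(m, ⌊log₂ m⌋)`-symmetric threshold circuit — one
labelled DAG (rank gadget + reduced-echelon insertion blocks + subset towers over the span
recursion), compiled. -/
theorem stub_symmetricF : ∃ q : Polynomial ℕ, ∀ m : ℕ, 4 ≤ m → ∀ i : FIdx m,
    HasSymCircuit tcBasis (Bud m (gOf m)) (q.eval m) (fun x => fData m x i) := by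
  obtain ⟨q, hq⟩ := stub_symmetricF_out.1
  refine ⟨q, fun m _ i => ?_⟩
  exact (SymF.hasSymCircuit_fData (stub_symmetricF_wires m) (stub_symmetricF_blocks m)
    (stub_symmetricF_struct m) (stub_symmetricF_aut m) stub_symmetricF_out i).mono (hq m)

end Summit.PneNP.PneNP.Theorems.HamCompilesKC
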